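import Literature.Computability.Complexity.DrivenSignMachineStrategy
import Literature.Computability.Complexity.NPClosureProofs
import Literature.Computability.Complexity.PRelHierarchy
import HarnessLib

/-!
# The oracle-driven sign machine, V: drivers assembled from three pieces (search, transmit, verdict)

Topic `Literature/Computability/Complexity`, grouping namespace `FKTransfer`, sequel of
`DrivenSignMachineStrategy.lean`. A driver language for the driven sign machine answers three
kinds of questions, told apart by the POSITION `|bits|` of the query `⟨1ⁿ, bits⟩` alone: with block
sizes `s(n)`, `m(n)`, period `P = s + m + 1` and `F(n)` frames,

* `|bits| = F · P` — the VERDICT round: answer by `Lfinal`;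
* `|bits| mod P < s` — a SEARCH round: answer by `Lsearch` (a prefix-search question);
* otherwise — a TRANSMISSION round: answer by `Ltrans` (a bit of the query to probe).

`driverLang s m F Lsearch Ltrans Lfinal` is this `P`-guarded case distinction
(`PRelHierarchy.caseSplit`, guards `FinalPos`, `SearchPos ∈ P` built from the tree's bricks), so

* **`driverLang_mem_NP`**: it is in `NP` as soon as `Lsearch, Lfinal ∈ NP` and `Ltrans ∈ P`
  (`caseSplit_mem_SigmaP 1`, `SigmaP_one_holds`);
* `mem_driverLang_of_final` / `_of_search` / `_of_trans` — which piece answers where;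
* **`implements_driverLang`**: the driver of `driverLang …` IMPLEMENTS a frame strategy
  (`R`, `code`) (`DrivenSignMachineStrategy.Implements`) as soon as, on the transcripts of valid
  histories, `Lsearch` answers the prefix-search questions of `R` and `Ltrans` spells `code`;
  `mem_driverLang_flat_iff` — on a full transcript the answer is `Lfinal`'s.

Together with `FKTransferAssembly.mem_PAddRelClass_of_strategy` this leaves, for a concrete
location procedure, only genuinely problem-specific obligations: the two membership
specifications, `Lsearch ∈ NP`, `Ltrans ∈ P`, `Lfinal ∈ NP`, and the geometry.

## References

* H. Fournier, P. Koiran, *Lower bounds are not easier over the reals: inside PH*, ICALP 2000,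
  LNCS 1853 = LIP RR-1999-21, §2.1 (the rounds of the location procedure), §3 Thm 3 (p. 11).
  [FournierKoiran2000]
* S. Arora, B. Barak, *Computational Complexity: A Modern Approach*, CUP 2009, §2.1 and Def. 5.3
  (closure of `NP` under `P`-guarded case distinctions). [AroraBarak2009]
-/

namespace Literature.Computability.Complexity

namespace FKTransfer

open _root_.Computability Polynomial Brick

/-- Length of a unary numeral. [folklore] -/
private theorem length_unaryEncodeNat (k : ℕ) : (unaryEncodeNat k).length = k := by
  induction k with
  | zero => rfl
  | succ k ih => rw [unaryEncodeNat, List.length_cons, ih]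

/-! ### The position guards -/

section Guards

variable (s m F : Polynomial ℕ)

/-- The period `P = s + m + 1` of the frames. [folklore] -/
noncomputable abbrev period : Polynomial ℕ := s + m + 1

/-- The one-bit test "verdict round": on `⟨1ⁿ, bits⟩`, `[|bits| = F(n) · P(n)]`. [folklore] -/
noncomputable def finalPosFn : List Bool → List Bool :=
  eqPairFn ∘ fanoutFn (onesFn ∘ sndF) (Plumb.polyFn (F * period s m) ∘ fstF)

/-- The one-bit test "search round": on `⟨1ⁿ, bits⟩`, `[|bits| mod P(n) < s(n)]`. [folklore] -/
noncomputable def searchPosFn : List Bool → List Bool :=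
  notFn (eqPairFn ∘ fanoutFn (Plumb.dropFn ∘ fanoutFn
    (Plumb.modLenFn ∘ fanoutFn (Plumb.polyFn (period s m) ∘ fstF) sndF) (Plumb.polyFn s ∘ fstF)) (fun _ => []))

/-- The guard language of verdict rounds. [folklore] -/
def FinalPos : Language Bool := {z | finalPosFn s m F z = [true]}

/-- The guard language of search rounds. [folklore] -/
def SearchPos : Language Bool := {z | searchPosFn s m z = [true]}

variable {s m F}

/-- Value of the verdict-round test. [folklore] -/
theorem finalPosFn_apply (n : ℕ) (bits : List Bool) :
    finalPosFn s m F (boolPair (unaryEncodeNat n) bits) =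
      [decide (bits.length = F.eval n * (s.eval n + m.eval n + 1))] := by
  simp only [finalPosFn, Function.comp_apply, fanoutFn_apply, sndF_boolPair, fstF_boolPair,
    Plumb.polyFn_apply, length_unaryEncodeNat, eqPairFn_boolPair, onesFn]
  congr 1
  apply Bool.decide_congr
  rw [show unaryEncodeNat bits.length = ones bits.length from ?_]
  · constructor
    · intro h; simpa [eval_mul, eval_add, eval_one] using congrArg List.length h
    · intro h; rw [h]; simp [eval_mul, eval_add]
  · clear n
    induction bits.length with
    | zero => rfl
    | succ k ih => rw [unaryEncodeNat, ih]; rfl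

/-- Value of the search-round test. [folklore] -/
theorem searchPosFn_apply (n : ℕ) (bits : List Bool) :
    searchPosFn s m (boolPair (unaryEncodeNat n) bits) =
      [decide (bits.length % (s.eval n + m.eval n + 1) < s.eval n)] := by
  have h1 : (eqPairFn ∘ fanoutFn (Plumb.dropFn ∘ fanoutFn
      (Plumb.modLenFn ∘ fanoutFn (Plumb.polyFn (period s m) ∘ fstF) sndF) (Plumb.polyFn s ∘ fstF)) (fun _ => []))
      (boolPair (unaryEncodeNat n) bits) = [decide (s.eval n ≤ bits.length % (s.eval n + m.eval n + 1))] := by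
    simp only [Function.comp_apply, fanoutFn_apply, sndF_boolPair, fstF_boolPair, Plumb.polyFn_apply,
      length_unaryEncodeNat, Plumb.modLenFn_boolPair, Plumb.dropFn_boolPair, eqPairFn_boolPair,
      eval_add, eval_one]
    congr 1
    apply Bool.decide_congr
    simp [ones, List.replicate_eq_nil_iff, Nat.sub_eq_zero_iff_le]
  rw [searchPosFn, notFn_apply h1]
  congr 1
  rw [← decide_not]
  exact Bool.decide_congr Nat.not_le

/-- `finalPosFn ∈ FP`. [folklore] -/
theorem finalPosFn_mem_FP : finalPosFn s m F ∈ FP :=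
  comp_mem_FP eqPairFn_mem_FP (fanoutFn_mem_FP (comp_mem_FP onesFn_mem_FP sndF_mem_FP)
    (comp_mem_FP (Plumb.polyFn_mem_FP _) fstF_mem_FP))

/-- `searchPosFn ∈ FP`. [folklore] -/
theorem searchPosFn_mem_FP : searchPosFn s m ∈ FP :=
  notFn_mem_FP (comp_mem_FP eqPairFn_mem_FP (fanoutFn_mem_FP (comp_mem_FP Plumb.dropFn_mem_FP
    (fanoutFn_mem_FP (comp_mem_FP Plumb.modLenFn_mem_FP (fanoutFn_mem_FP
      (comp_mem_FP (Plumb.polyFn_mem_FP _) fstF_mem_FP) sndF_mem_FP))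
      (comp_mem_FP (Plumb.polyFn_mem_FP _) fstF_mem_FP))) (const_mem_FP _)))

/-- `FinalPos ∈ P`. [folklore] -/
theorem FinalPos_mem_P : FinalPos s m F ∈ Classes.P :=
  mem_P_of_mem_FP finalPosFn_mem_FP _ fun z =>
    ⟨fun h => h, fun h => (eqPairFn_eq_or (fanoutFn (onesFn ∘ sndF) (Plumb.polyFn (F * period s m) ∘ fstF) z)).resolve_left h⟩

/-- `SearchPos ∈ P`. [folklore] -/
theorem SearchPos_mem_P : SearchPos s m ∈ Classes.P :=
  mem_P_of_mem_FP searchPosFn_mem_FP _ fun z =>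
    ⟨fun h => h, fun h => by
      obtain ⟨b, hb⟩ := oneBit_notFn ((eqPairFn_eq_or_oneBit).comp _) z
      cases b
      · exact hb
      · exact absurd hb h⟩
where
  /-- `eqPairFn` is one-bit. [folklore] -/
  eqPairFn_eq_or_oneBit : OneBit eqPairFn := fun w => by
    rcases eqPairFn_eq_or w with h | h
    · exact ⟨true, h⟩
    · exact ⟨false, h⟩

/-- Membership of `⟨1ⁿ, bits⟩` in `FinalPos`. [folklore] -/
theorem boolPair_mem_FinalPos {n : ℕ} {bits : List Bool} :
    boolPair (unaryEncodeNat n) bits ∈ FinalPos s m F ↔ bits.length = F.eval n * (s.eval n + m.eval n + 1) := by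
  change finalPosFn s m F _ = [true] ↔ _
  rw [finalPosFn_apply]
  simp

/-- Membership of `⟨1ⁿ, bits⟩` in `SearchPos`. [folklore] -/
theorem boolPair_mem_SearchPos {n : ℕ} {bits : List Bool} :
    boolPair (unaryEncodeNat n) bits ∈ SearchPos s m ↔ bits.length % (s.eval n + m.eval n + 1) < s.eval n := by
  change searchPosFn s m _ = [true] ↔ _
  rw [searchPosFn_apply]
  simp

end Guards

/-! ### The driver language -/

section Driver

variable (s m F : Polynomial ℕ) (Lsearch Ltrans Lfinal : Language Bool)

/-- **The driver assembled from three pieces**: the verdict language on verdict rounds, the search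
language on search rounds, the transmission language otherwise.
[cite: FournierKoiran2000, §2.1 and Thm 3 (p. 11)] -/
def driverLang : Language Bool :=
  caseSplit (FinalPos s m F) Lfinal (caseSplit (SearchPos s m) Lsearch Ltrans)

variable {s m F Lsearch Ltrans Lfinal}

/-- **The assembled driver is in `NP`** for `Lsearch, Lfinal ∈ NP` and `Ltrans ∈ P`.
[cite: AroraBarak2009, Def. 5.3 (closure properties)] -/
theorem driverLang_mem_NP (hsearch : Lsearch ∈ Nondeterministic.NP) (htrans : Ltrans ∈ Classes.P)
    (hfinal : Lfinal ∈ Nondeterministic.NP) : driverLang s m F Lsearch Ltrans Lfinal ∈ Nondeterministic.NP := by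
  rw [← SigmaP_one_holds] at hsearch hfinal ⊢
  exact caseSplit_mem_SigmaP 1 FinalPos_mem_P hfinal
    (caseSplit_mem_SigmaP 1 SearchPos_mem_P hsearch (P_subset_SigmaP 1 htrans))

variable {n : ℕ} {bits : List Bool}

/-- On a verdict round the verdict language answers. [folklore] -/
theorem mem_driverLang_of_final (h : bits.length = F.eval n * (s.eval n + m.eval n + 1)) :
    boolPair (unaryEncodeNat n) bits ∈ driverLang s m F Lsearch Ltrans Lfinal ↔
      boolPair (unaryEncodeNat n) bits ∈ Lfinal := by
  rw [driverLang, mem_caseSplit_iff]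
  have hmem : boolPair (unaryEncodeNat n) bits ∈ FinalPos s m F := boolPair_mem_FinalPos.2 h
  exact ⟨fun h' => h'.1 hmem, fun h' => ⟨fun _ => h', fun hn => absurd hmem hn⟩⟩

/-- On a search round the search language answers. [folklore] -/
theorem mem_driverLang_of_search (hF : bits.length ≠ F.eval n * (s.eval n + m.eval n + 1))
    (hs : bits.length % (s.eval n + m.eval n + 1) < s.eval n) :
    boolPair (unaryEncodeNat n) bits ∈ driverLang s m F Lsearch Ltrans Lfinal ↔
      boolPair (unaryEncodeNat n) bits ∈ Lsearch := by
  rw [driverLang, mem_caseSplit_iff, mem_caseSplit_iff]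
  have h1 : boolPair (unaryEncodeNat n) bits ∉ FinalPos s m F := fun h => hF (boolPair_mem_FinalPos.1 h)
  have h2 : boolPair (unaryEncodeNat n) bits ∈ SearchPos s m := boolPair_mem_SearchPos.2 hs
  exact ⟨fun h' => (h'.2 h1).1 h2, fun h' => ⟨fun hf => absurd hf h1, fun _ => ⟨fun _ => h', fun hn => absurd h2 hn⟩⟩⟩

/-- On a transmission round the transmission language answers. [folklore] -/
theorem mem_driverLang_of_trans (hF : bits.length ≠ F.eval n * (s.eval n + m.eval n + 1))
    (hs : ¬ bits.length % (s.eval n + m.eval n + 1) < s.eval n) :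
    boolPair (unaryEncodeNat n) bits ∈ driverLang s m F Lsearch Ltrans Lfinal ↔
      boolPair (unaryEncodeNat n) bits ∈ Ltrans := by
  rw [driverLang, mem_caseSplit_iff, mem_caseSplit_iff]
  have h1 : boolPair (unaryEncodeNat n) bits ∉ FinalPos s m F := fun h => hF (boolPair_mem_FinalPos.1 h)
  have h2 : boolPair (unaryEncodeNat n) bits ∉ SearchPos s m := fun h => hs (boolPair_mem_SearchPos.1 h)
  exact ⟨fun h' => (h'.2 h1).2 h2, fun h' => ⟨fun hf => absurd hf h1, fun _ => ⟨fun hy => absurd hy h2, fun _ => h'⟩⟩⟩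

end Driver

/-! ### The assembled driver implements a strategy -/

section Implements

variable {s m F : Polynomial ℕ} {Lsearch Ltrans Lfinal : Language Bool}
  {R : List (List Bool × Bool) → List Bool → Prop}
  {code : List (List Bool × Bool) → List Bool → List Bool} {σ : List Bool → Bool} {n : ℕ}

/-- **The assembled driver implements the strategy `(R, code)`** at dimension `n` as soon as, after
the transcript `flat code h` of every valid history `h` of fewer than `F(n)` frames, `Lsearch`
answers the prefix-search questions of `R h` (`|p| < s(n)`) and, after an admissible witness `w`,
`Ltrans` answers the bits of `code h w` (`|p| < m(n)`). [cite: FournierKoiran2000, §2.1] -/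
theorem implements_driverLang (hcode : ∀ h w, (code h w).length = m.eval n)
    (hsR : ∀ h w, R h w → w.length = s.eval n)
    (hS : ∀ (h : List (List Bool × Bool)) (p : List Bool), h.length < F.eval n → ValidHist R code σ h →
      p.length < s.eval n →
        (boolPair (unaryEncodeNat n) (flat code h ++ p) ∈ Lsearch ↔ PrefixExtendable (R h) (s.eval n) (p ++ [true])))
    (hTr : ∀ (h : List (List Bool × Bool)) (w p : List Bool), h.length < F.eval n → ValidHist R code σ h →
      w.length = s.eval n → R h w → p.length < m.eval n →
        (boolPair (unaryEncodeNat n) (flat code h ++ w ++ p) ∈ Ltrans ↔ (code h w).getD p.length false = true)) :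
    Implements R code σ (driverOf (driverLang s m F Lsearch Ltrans Lfinal) n) (s.eval n) (F.eval n) := by
  intro h hF hv
  have hl : (flat code h).length = h.length * (s.eval n + m.eval n + 1) := length_flat hcode h (hv.length_eq hsR)
  have hlt : ∀ j < s.eval n + m.eval n + 1, (flat code h).length + j < F.eval n * (s.eval n + m.eval n + 1) := by
    intro j hj
    have := Nat.mul_le_mul_right (s.eval n + m.eval n + 1) hF
    rw [Nat.succ_mul] at this
    omega
  have hmod : ∀ j < s.eval n + m.eval n + 1, ((flat code h).length + j) % (s.eval n + m.eval n + 1) = j := by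
    intro j hj
    rw [hl, Nat.add_comm, Nat.add_mul_mod_self_right, Nat.mod_eq_of_lt hj]
  have hδ : ∀ bits : List Bool, driverOf (driverLang s m F Lsearch Ltrans Lfinal) n bits = true ↔
      boolPair (unaryEncodeNat n) bits ∈ driverLang s m F Lsearch Ltrans Lfinal := fun bits =>
    (Set.mem_iff_boolIndicator _ _).symm
  refine ⟨fun p hp => ?_, fun w hw hRw p hp => ?_⟩
  · -- search rounds
    rw [hδ, mem_driverLang_of_search, hS h p hF hv hp]
    · rw [List.length_append]; exact Nat.ne_of_lt (hlt _ (by omega))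
    · rw [List.length_append, hmod _ (by omega)]; exact hp
  · -- transmission rounds
    rw [hcode] at hp
    have hlen : (flat code h ++ w ++ p).length = (flat code h).length + (s.eval n + p.length) := by
      rw [List.length_append, List.length_append, hw, Nat.add_assoc]
    have hmem : boolPair (unaryEncodeNat n) (flat code h ++ w ++ p) ∈ driverLang s m F Lsearch Ltrans Lfinal ↔
        (code h w).getD p.length false = true := by
      rw [mem_driverLang_of_trans, hTr h w p hF hv hw hRw hp]
      · rw [hlen]; exact Nat.ne_of_lt (hlt _ (by omega))
      · rw [hlen, hmod _ (by omega)]; omega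
    rw [Bool.eq_iff_iff, hδ]
    exact hmem

/-- **On the full transcript the verdict language answers.** [cite: FournierKoiran2000, Thm 3 (p. 11)] -/
theorem mem_driverLang_flat_iff (hcode : ∀ h w, (code h w).length = m.eval n)
    (hsR : ∀ h w, R h w → w.length = s.eval n)
    {h : List (List Bool × Bool)} (hF : h.length = F.eval n) (hv : ValidHist R code σ h) :
    boolPair (unaryEncodeNat n) (flat code h) ∈ driverLang s m F Lsearch Ltrans Lfinal ↔
      boolPair (unaryEncodeNat n) (flat code h) ∈ Lfinal :=
  mem_driverLang_of_final (by rw [length_flat hcode h (hv.length_eq hsR), hF])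

end Implements

end FKTransfer

end Literature.Computability.Complexity
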